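/-
Origin: expansion seat `planner-pub-hodgecm-pv03-0`, handover v4 2026-08-18T03:54:46Z (`HOME/pub-hodgecm-pv03/lean/Pv03/PerL34/Ball.lean`, md5 72ed3a7d, 497 lines);
landed by the gen-5 packager in gate run 20 as `HodgeCM/PerL34/Ball.lean` (verbatim).
-/
/-
Copyright: pub-hodgecm formalisation cell (harness21, 2026). New file (not vendored).
Origin: HOME/pub-hodgecm-pv03/lean/Pv03/PerL34/Ball.lean (WIP module `Pv03.PerL34.Ball`; intended final place
`HodgeCM/PerL34/Ball.lean` = module `HodgeCM.PerL34.Ball`) (seat planner-pub-hodgecm-pv03-0, DAG node N33,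
PerL v5 Prop 4.3, tex ll. 667–681: the concrete topological shell of the line-field argument).
-/
import Mathlib

/-!
# The complex 2-ball `𝔹²` with its `U(2,1)`-action and the cotangent cocycle (PerL v5 Prop 4.3, ll. 667–681)

This file is pure Mathlib mathematics: no package declaration is used.  It builds the CANONICAL MODEL of the
abstract topological shell `(G, X, W, A, x₀, e)` over which the line-field contradiction of PerL v5 Prop 4.3
(DAG node N33e, `HodgeCM.PerL34.N33e_statement`, seat pv01) and its consumer
`HodgeCM.PerL34.WedgeToClasses.N33eClosed` / `FormsModelT` (seat pv03, `WedgeFromLineField.lean`) are stated,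
and PROVES for it three of the four "PRINT shell facts" that `FormsModelT.StepsPrint` lists as inputs:

* `G = U21`      : the subgroup `{g ∈ GL₃(ℂ) : gᴴ J g = J}`, `J = diag(1,1,-1)` — the real points `U(2,1)` of the
                   unitary group of signature `(2,1)` at the place `ι₁` (PerL l. 67, l. 667);
* `X = Ball`     : `𝔹² = {z ∈ ℂ² : |z₀|² + |z₁|² < 1}` with the projective (fractional-linear) action
                   `g • z = ((g(z,1))₀, (g(z,1))₁) / (g(z,1))₂` — a `MulAction` with `ContinuousSMul`
                   (`instMulActionU21Ball`, `instContinuousSMulU21Ball`);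
* `W = Fin 2 → ℂ`: the cotangent fibre in the frame `dz₀, dz₁` (`e = LinearEquiv.refl`), `x₀ = 0`;
* `A g z`        : the COTANGENT COCYCLE `((D_z g)⁻¹)ᵀ`, where `Jac g z` is the Jacobian matrix of `z ↦ g • z`
                   (`Jac`, `det_Jac : det (Jac g z) = det g / (g(z,1))₂³`, `coT`, `coT_mul_transpose_Jac : coT · Jacᵀ = 1`).

PROVED (kernel, Mathlib only):
* `transitive`     — `U(2,1)` acts transitively on `𝔹²` (boost `boost r` times rotation `rot z`), i.e.
                     `FormsModelT.Print_transitive` for this model;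
* `A_injective`, `A_continuous` — the cocycle is fibrewise injective and continuous in `g`, i.e.
                     `FormsModelT.Print_cocycle`;
* `isotropy_SU2`   — every `s ∈ SU(2)` is the cotangent action at `x₀ = 0` of the stabiliser element
                     `blockDiag (s̄) 1 ∈ U(2,1)` (scalar `c = 1`), i.e. `FormsModelT.Print_isotropy`
                     (PerL ll. 677–680: "`K_{x₀}` acts on `T^*_{x₀}𝔹² ≅ ℂ²` through the standard representation
                     of `U(2)` twisted by a character, and `SU(2)` is transitive on lines").

NOT covered here (stays a PRINT input of node N33): `Print_dense` — density of the image `Δ` of `G_U(L₀)` in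
`U(2,1)` (real approximation, [San] Cor. 3.5(iii) / [PR] Thm. 7.7, PerL ll. 672–677); `Δ` is arbitrary below.

The specialisation of the closed statement `N33eClosed` to this model is `HodgeCM.PerL34.BallGlue.n33e_ball`
(file `BallGlue.lean`, which imports the N33 chain); this file is kept free of package imports.
-/

noncomputable section

open Matrix Complex ComplexConjugate

namespace HodgeCM
namespace PerL34
namespace BallModel

/-! ## The form `J` and the group `U(2,1)` -/

/-- `J = diag(1, 1, -1)` on `ℂ³`. -/
def J : Matrix (Fin 3) (Fin 3) ℂ := Matrix.diagonal ![1, 1, -1]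

/-- (Ported verbatim from the HodgeCMPerL package; no docstring in the source.) -/
@[simp] theorem J_apply_00 : J 0 0 = 1 := by simp [J]
/-- (Ported verbatim from the HodgeCMPerL package; no docstring in the source.) -/
@[simp] theorem J_apply_11 : J 1 1 = 1 := by simp [J]
/-- (Ported verbatim from the HodgeCMPerL package; no docstring in the source.) -/
@[simp] theorem J_apply_22 : J 2 2 = -1 := by simp [J]
/-- (Ported verbatim from the HodgeCMPerL package; no docstring in the source.) -/
theorem J_apply_of_ne {i j : Fin 3} (h : i ≠ j) : J i j = 0 := by simp [J, Matrix.diagonal_apply_ne _ h]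

/-- (Ported verbatim from the HodgeCMPerL package; no docstring in the source.) -/
theorem det_J : J.det = -1 := by
  simp [J, Matrix.det_diagonal, Fin.prod_univ_three]

/-- The ambient group `GL₃(ℂ)`. -/
abbrev GL3 : Type := GL (Fin 3) ℂ

/-- `U(2,1) = {g ∈ GL₃(ℂ) : gᴴ J g = J}` as a subgroup of `GL₃(ℂ)`. -/
def U21 : Subgroup GL3 where
  carrier := {g | (g : Matrix (Fin 3) (Fin 3) ℂ)ᴴ * J * (g : Matrix (Fin 3) (Fin 3) ℂ) = J}
  mul_mem' := by
    intro g h hg hh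
    simp only [Set.mem_setOf_eq, Units.val_mul, conjTranspose_mul] at hg hh ⊢
    calc (h : Matrix (Fin 3) (Fin 3) ℂ)ᴴ * (g : Matrix (Fin 3) (Fin 3) ℂ)ᴴ * J *
          ((g : Matrix (Fin 3) (Fin 3) ℂ) * (h : Matrix (Fin 3) (Fin 3) ℂ))
        = (h : Matrix (Fin 3) (Fin 3) ℂ)ᴴ * ((g : Matrix (Fin 3) (Fin 3) ℂ)ᴴ * J *
          (g : Matrix (Fin 3) (Fin 3) ℂ)) * (h : Matrix (Fin 3) (Fin 3) ℂ) := by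
          simp only [Matrix.mul_assoc]
      _ = J := by rw [hg, hh]
  one_mem' := by simp
  inv_mem' := by
    intro g hg
    simp only [Set.mem_setOf_eq] at hg ⊢
    set gi : Matrix (Fin 3) (Fin 3) ℂ := ((g⁻¹ : GL3) : Matrix (Fin 3) (Fin 3) ℂ) with hgi
    have hmul : (g : Matrix (Fin 3) (Fin 3) ℂ) * gi = 1 := by
      rw [hgi, ← Units.val_mul, mul_inv_cancel, Units.val_one]
    calc giᴴ * J * gi = giᴴ * ((g : Matrix (Fin 3) (Fin 3) ℂ)ᴴ * J * (g : Matrix (Fin 3) (Fin 3) ℂ)) * gi := by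
          rw [hg]
      _ = ((g : Matrix (Fin 3) (Fin 3) ℂ) * gi)ᴴ * J * ((g : Matrix (Fin 3) (Fin 3) ℂ) * gi) := by
          simp only [conjTranspose_mul, Matrix.mul_assoc]
      _ = J := by rw [hmul]; simp

/-- The matrix of an element of `U(2,1)`. -/
abbrev mat (g : U21) : Matrix (Fin 3) (Fin 3) ℂ := ((g : GL3) : Matrix (Fin 3) (Fin 3) ℂ)

/-- (Ported verbatim from the HodgeCMPerL package; no docstring in the source.) -/
theorem mat_mem (g : U21) : (mat g)ᴴ * J * mat g = J := g.2

/-- (Ported verbatim from the HodgeCMPerL package; no docstring in the source.) -/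
@[simp] theorem mat_mul (g h : U21) : mat (g * h) = mat g * mat h := by
  simp [mat]

/-- (Ported verbatim from the HodgeCMPerL package; no docstring in the source.) -/
@[simp] theorem mat_one : mat 1 = 1 := by simp [mat]

/-- (Ported verbatim from the HodgeCMPerL package; no docstring in the source.) -/
theorem continuous_mat : Continuous mat :=
  Units.continuous_val.comp continuous_subtype_val

/-- A matrix preserving `J` has non-zero determinant. -/
theorem det_ne_zero_of_preserves {g : Matrix (Fin 3) (Fin 3) ℂ} (h : gᴴ * J * g = J) : g.det ≠ 0 := by
  intro h0
  have := congrArg Matrix.det h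
  rw [det_mul, det_mul, h0, mul_zero, det_J] at this
  norm_num at this

/-- Constructor: a matrix preserving `J` defines an element of `U(2,1)`. -/
def mkU21 (g : Matrix (Fin 3) (Fin 3) ℂ) (h : gᴴ * J * g = J) : U21 :=
  ⟨Matrix.GeneralLinearGroup.mkOfDetNeZero g (det_ne_zero_of_preserves h), h⟩

/-- (Ported verbatim from the HodgeCMPerL package; no docstring in the source.) -/
@[simp] theorem mat_mkU21 (g : Matrix (Fin 3) (Fin 3) ℂ) (h : gᴴ * J * g = J) : mat (mkU21 g h) = g := rfl

/-- (Ported verbatim from the HodgeCMPerL package; no docstring in the source.) -/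
theorem det_mat_ne_zero (g : U21) : (mat g).det ≠ 0 := det_ne_zero_of_preserves (mat_mem g)

/-! ## The Hermitian form of signature `(2,1)` and its invariance -/

/-- The real quadratic form `Q(v) = |v₀|² + |v₁|² - |v₂|²`. -/
def Q (v : Fin 3 → ℂ) : ℝ := ‖v 0‖ ^ 2 + ‖v 1‖ ^ 2 - ‖v 2‖ ^ 2

/-- (Ported verbatim from the HodgeCMPerL package; no docstring in the source.) -/
theorem form_eq_Q (v : Fin 3 → ℂ) : star v ⬝ᵥ (J *ᵥ v) = ((Q v : ℝ) : ℂ) := by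
  have h0 := Complex.conj_mul' (v 0)
  have h1 := Complex.conj_mul' (v 1)
  have h2 := Complex.conj_mul' (v 2)
  simp only [J, mulVec_diagonal, dotProduct, Fin.sum_univ_three, Pi.star_apply, Complex.star_def, Q,
    Matrix.cons_val_zero, Matrix.cons_val_one, Matrix.cons_val]
  push_cast
  linear_combination h0 + h1 - h2

/-- (Ported verbatim from the HodgeCMPerL package; no docstring in the source.) -/
theorem form_invariant {g : Matrix (Fin 3) (Fin 3) ℂ} (h : gᴴ * J * g = J) (v : Fin 3 → ℂ) :
    star (g *ᵥ v) ⬝ᵥ (J *ᵥ (g *ᵥ v)) = star v ⬝ᵥ (J *ᵥ v) := by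
  rw [Matrix.star_mulVec, Matrix.mulVec_mulVec, Matrix.dotProduct_mulVec, Matrix.vecMul_vecMul,
    ← Matrix.mul_assoc, h, ← Matrix.dotProduct_mulVec]

/-- (Ported verbatim from the HodgeCMPerL package; no docstring in the source.) -/
theorem Q_mulVec {g : Matrix (Fin 3) (Fin 3) ℂ} (h : gᴴ * J * g = J) (v : Fin 3 → ℂ) : Q (g *ᵥ v) = Q v := by
  have := form_invariant h v
  rw [form_eq_Q, form_eq_Q] at this
  exact_mod_cast this

/-! ## The ball and the action -/

/-- `|z₀|² + |z₁|²`. -/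
def nsq (z : Fin 2 → ℂ) : ℝ := ‖z 0‖ ^ 2 + ‖z 1‖ ^ 2

/-- (Ported verbatim from the HodgeCMPerL package; no docstring in the source.) -/
theorem nsq_nonneg (z : Fin 2 → ℂ) : 0 ≤ nsq z := by unfold nsq; positivity

/-- The complex 2-ball `𝔹² = {z ∈ ℂ² : |z₀|² + |z₁|² < 1}`. -/
def Ball : Type := {z : Fin 2 → ℂ // nsq z < 1}

/-- (Ported verbatim from the HodgeCMPerL package; no docstring in the source.) -/
instance : TopologicalSpace Ball := instTopologicalSpaceSubtype

/-- The base point `x₀ = 0 ∈ 𝔹²`. -/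
def x₀ : Ball := ⟨0, by simp [nsq]⟩

/-- (Ported verbatim from the HodgeCMPerL package; no docstring in the source.) -/
@[simp] theorem x₀_val : (x₀.1 : Fin 2 → ℂ) = 0 := rfl

/-- The lift `z ↦ (z₀, z₁, 1) ∈ ℂ³` of a point of the ball (a `J`-negative vector). -/
def lift (z : Ball) : Fin 3 → ℂ := ![z.1 0, z.1 1, 1]

/-- (Ported verbatim from the HodgeCMPerL package; no docstring in the source.) -/
@[simp] theorem lift_0 (z : Ball) : lift z 0 = z.1 0 := rfl
/-- (Ported verbatim from the HodgeCMPerL package; no docstring in the source.) -/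
@[simp] theorem lift_1 (z : Ball) : lift z 1 = z.1 1 := rfl
/-- (Ported verbatim from the HodgeCMPerL package; no docstring in the source.) -/
@[simp] theorem lift_2 (z : Ball) : lift z 2 = 1 := rfl

/-- (Ported verbatim from the HodgeCMPerL package; no docstring in the source.) -/
theorem Q_lift (z : Ball) : Q (lift z) < 0 := by
  have := z.2; simp only [Q, lift_0, lift_1, lift_2, norm_one, one_pow, nsq] at this ⊢; linarith

/-- For a `J`-negative vector the last coordinate does not vanish. -/
theorem ne_zero_of_Q_neg {w : Fin 3 → ℂ} (hw : Q w < 0) : w 2 ≠ 0 := by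
  intro h; simp only [Q, h, norm_zero] at hw; nlinarith [sq_nonneg ‖w 0‖, sq_nonneg ‖w 1‖]

/-- Projection of a `J`-negative vector to the ball: `w ↦ (w₀/w₂, w₁/w₂)`. -/
def proj (w : Fin 3 → ℂ) (hw : Q w < 0) : Ball :=
  ⟨![w 0 / w 2, w 1 / w 2], by
    have h2 := ne_zero_of_Q_neg hw
    have hpos : 0 < ‖w 2‖ ^ 2 := by positivity
    simp only [nsq, Matrix.cons_val_zero, Matrix.cons_val_one, norm_div, div_pow]
    rw [← add_div, div_lt_one hpos]
    simp only [Q] at hw; linarith⟩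

/-- (Ported verbatim from the HodgeCMPerL package; no docstring in the source.) -/
@[simp] theorem proj_val_0 (w : Fin 3 → ℂ) (hw : Q w < 0) : (proj w hw).1 0 = w 0 / w 2 := rfl
/-- (Ported verbatim from the HodgeCMPerL package; no docstring in the source.) -/
@[simp] theorem proj_val_1 (w : Fin 3 → ℂ) (hw : Q w < 0) : (proj w hw).1 1 = w 1 / w 2 := rfl

/-- (Ported verbatim from the HodgeCMPerL package; no docstring in the source.) -/
theorem proj_val (w : Fin 3 → ℂ) (hw : Q w < 0) (i : Fin 2) : (proj w hw).1 i = w (Fin.castSucc i) / w 2 := by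
  fin_cases i <;> rfl

/-- The image `g · (z, 1)` of the lift. -/
def W3 (g : U21) (z : Ball) : Fin 3 → ℂ := mat g *ᵥ lift z

/-- (Ported verbatim from the HodgeCMPerL package; no docstring in the source.) -/
theorem Q_W3 (g : U21) (z : Ball) : Q (W3 g z) < 0 := by
  unfold W3; rw [Q_mulVec (mat_mem g)]; exact Q_lift z

/-- (Ported verbatim from the HodgeCMPerL package; no docstring in the source.) -/
theorem W3_2_ne_zero (g : U21) (z : Ball) : W3 g z 2 ≠ 0 := ne_zero_of_Q_neg (Q_W3 g z)

/-- (Ported verbatim from the HodgeCMPerL package; no docstring in the source.) -/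
theorem W3_apply (g : U21) (z : Ball) (k : Fin 3) :
    W3 g z k = mat g k 0 * z.1 0 + mat g k 1 * z.1 1 + mat g k 2 := by
  simp [W3, mulVec, dotProduct, Fin.sum_univ_three]

/-- The action `g • z := proj (g · lift z)`. -/
def act (g : U21) (z : Ball) : Ball := proj (W3 g z) (Q_W3 g z)

/-- (Ported verbatim from the HodgeCMPerL package; no docstring in the source.) -/
theorem act_val (g : U21) (z : Ball) (i : Fin 2) : (act g z).1 i = W3 g z (Fin.castSucc i) / W3 g z 2 :=
  proj_val _ _ i

/-- (Ported verbatim from the HodgeCMPerL package; no docstring in the source.) -/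
theorem Ball.ext {z z' : Ball} (h : ∀ i, z.1 i = z'.1 i) : z = z' := Subtype.ext (funext h)

/-- (Ported verbatim from the HodgeCMPerL package; no docstring in the source.) -/
theorem lift_act (g : U21) (z : Ball) : lift (act g z) = (W3 g z 2)⁻¹ • W3 g z := by
  have h2 := W3_2_ne_zero g z
  funext k
  fin_cases k
  · simp [act, div_eq_inv_mul]
  · simp [act, div_eq_inv_mul]
  · simp [h2]

/-- (Ported verbatim from the HodgeCMPerL package; no docstring in the source.) -/
instance instMulActionU21Ball : MulAction U21 Ball where
  smul := act
  one_smul z := by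
    apply Ball.ext; intro i
    change (act 1 z).1 i = z.1 i
    rw [act_val]
    fin_cases i <;> simp [W3]
  mul_smul g h z := by
    apply Ball.ext; intro i
    change (act (g * h) z).1 i = (act g (act h z)).1 i
    rw [act_val, act_val]
    have hW : W3 g (act h z) = (W3 h z 2)⁻¹ • (mat g *ᵥ W3 h z) := by
      unfold W3; rw [lift_act, Matrix.mulVec_smul]; rfl
    have hgh : W3 (g * h) z = mat g *ᵥ W3 h z := by
      unfold W3; rw [mat_mul, ← Matrix.mulVec_mulVec]
    rw [hW, hgh]
    have h2 := W3_2_ne_zero h z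
    simp only [Pi.smul_apply, smul_eq_mul]
    rw [mul_div_mul_left _ _ (inv_ne_zero h2)]

/-- (Ported verbatim from the HodgeCMPerL package; no docstring in the source.) -/
theorem smul_def (g : U21) (z : Ball) : g • z = act g z := rfl

/-- (Ported verbatim from the HodgeCMPerL package; no docstring in the source.) -/
theorem smul_val (g : U21) (z : Ball) (i : Fin 2) : (g • z).1 i = W3 g z (Fin.castSucc i) / W3 g z 2 :=
  act_val g z i

/-- Continuity of `(g, z) ↦ (g · lift z)_k`. -/
theorem continuous_W3 (k : Fin 3) : Continuous fun p : U21 × Ball => W3 p.1 p.2 k := by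
  have hm : Continuous fun p : U21 × Ball => mat p.1 := continuous_mat.comp continuous_fst
  have hz : ∀ i : Fin 2, Continuous fun p : U21 × Ball => p.2.1 i := fun i =>
    (continuous_apply i).comp (continuous_subtype_val.comp continuous_snd)
  simp only [W3_apply]
  exact (((hm.matrix_elem k 0).mul (hz 0)).add ((hm.matrix_elem k 1).mul (hz 1))).add (hm.matrix_elem k 2)

/-- (Ported verbatim from the HodgeCMPerL package; no docstring in the source.) -/
instance instContinuousSMulU21Ball : ContinuousSMul U21 Ball where
  continuous_smul := by
    refine Topology.IsEmbedding.subtypeVal.continuous_iff.2 (continuous_pi fun i => ?_)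
    exact ((continuous_W3 _).div (continuous_W3 2) fun p => W3_2_ne_zero p.1 p.2).congr
      fun p => (smul_val p.1 p.2 i).symm

/-- (Ported verbatim from the HodgeCMPerL package; no docstring in the source.) -/
theorem continuous_W3_left (z : Ball) (k : Fin 3) : Continuous fun g : U21 => W3 g z k :=
  (continuous_W3 k).comp (continuous_id.prodMk continuous_const)

/-! ## The Jacobian of the action and the cotangent cocycle -/

/-- Jacobian matrix of `z ↦ g • z` at `z` in the coordinates `z₀, z₁`: with `w = g·(z,1)`,
`∂(w_i/w₂)/∂z_j = (g_{ij} w₂ - w_i g_{2j}) / w₂²`. -/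
def Jac (g : U21) (z : Ball) : Matrix (Fin 2) (Fin 2) ℂ :=
  Matrix.of fun i j => (mat g (Fin.castSucc i) (Fin.castSucc j) * W3 g z 2 -
    W3 g z (Fin.castSucc i) * mat g 2 (Fin.castSucc j)) / W3 g z 2 ^ 2

/-- The classical formula `det D(g)(z) = det g / w₂³`. -/
theorem det_Jac (g : U21) (z : Ball) : (Jac g z).det = (mat g).det / W3 g z 2 ^ 3 := by
  have h2 := W3_2_ne_zero g z
  rw [W3_apply] at h2
  simp only [Matrix.det_fin_two, Matrix.det_fin_three, Jac, Matrix.of_apply, W3_apply, Fin.castSucc_zero,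
    Fin.castSucc_one]
  field_simp
  ring

/-- (Ported verbatim from the HodgeCMPerL package; no docstring in the source.) -/
theorem det_Jac_ne_zero (g : U21) (z : Ball) : (Jac g z).det ≠ 0 := by
  rw [det_Jac]; exact div_ne_zero (det_mat_ne_zero g) (pow_ne_zero _ (W3_2_ne_zero g z))

/-- The cotangent cocycle matrix `((D_z g)⁻¹)ᵀ`, written out by the `2 × 2` adjugate formula. -/
def coT (g : U21) (z : Ball) : Matrix (Fin 2) (Fin 2) ℂ :=
  ((Jac g z).det)⁻¹ • !![Jac g z 1 1, -Jac g z 1 0; -Jac g z 0 1, Jac g z 0 0]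

/-- `coT g z` is the inverse transpose of the Jacobian. -/
theorem coT_mul_transpose_Jac (g : U21) (z : Ball) : coT g z * (Jac g z)ᵀ = 1 := by
  have hd := det_Jac_ne_zero g z
  rw [Matrix.det_fin_two] at hd
  ext i j
  fin_cases i <;> fin_cases j <;>
    · simp [coT, Matrix.mul_apply, Fin.sum_univ_two, Matrix.det_fin_two]; field_simp; ring1

/-- (Ported verbatim from the HodgeCMPerL package; no docstring in the source.) -/
theorem det_coT (g : U21) (z : Ball) : (coT g z).det = ((Jac g z).det)⁻¹ := by
  have hd := det_Jac_ne_zero g z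
  rw [Matrix.det_fin_two] at hd
  simp only [coT, Matrix.det_smul, Matrix.det_fin_two, Fintype.card_fin]
  simp only [Matrix.of_apply, Matrix.cons_val', Matrix.cons_val_zero, Matrix.cons_val_one, Matrix.empty_val',
    Matrix.cons_val_fin_one]
  field_simp

/-- The cotangent cocycle `A g z = ((D_z g)⁻¹)ᵀ` as a continuous linear map of `W = ℂ²`. -/
def A (g : U21) (z : Ball) : (Fin 2 → ℂ) →L[ℂ] (Fin 2 → ℂ) :=
  LinearMap.toContinuousLinearMap (Matrix.mulVecLin (coT g z))

/-- (Ported verbatim from the HodgeCMPerL package; no docstring in the source.) -/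
@[simp] theorem A_apply (g : U21) (z : Ball) (w : Fin 2 → ℂ) : A g z w = coT g z *ᵥ w := rfl

/-- **Print_cocycle, first half:** the cocycle is fibrewise injective. -/
theorem A_injective (g : U21) (z : Ball) : Function.Injective (A g z) := by
  have hU : IsUnit (coT g z) := by
    rw [Matrix.isUnit_iff_isUnit_det, det_coT, isUnit_iff_ne_zero]
    exact inv_ne_zero (det_Jac_ne_zero g z)
  intro v w h
  exact Matrix.mulVec_injective_iff_isUnit.2 hU h

/-- (Ported verbatim from the HodgeCMPerL package; no docstring in the source.) -/
theorem continuous_Jac (z : Ball) : Continuous fun g : U21 => Jac g z := by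
  refine continuous_matrix fun i j => ?_
  simp only [Jac, Matrix.of_apply]
  exact (((continuous_mat.matrix_elem _ _).mul (continuous_W3_left z 2)).sub
    ((continuous_W3_left z _).mul (continuous_mat.matrix_elem _ _))).div
    ((continuous_W3_left z 2).pow 2) fun g => pow_ne_zero _ (W3_2_ne_zero g z)

/-- (Ported verbatim from the HodgeCMPerL package; no docstring in the source.) -/
theorem continuous_coT (z : Ball) : Continuous fun g : U21 => coT g z := by
  have hd : Continuous fun g : U21 => ((Jac g z).det)⁻¹ :=
    ((continuous_Jac z).matrix_det).inv₀ fun g => det_Jac_ne_zero g z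
  have hJ := continuous_Jac z
  refine hd.smul (continuous_matrix fun i j => ?_)
  fin_cases i <;> fin_cases j <;>
    simp only [Matrix.of_apply, Matrix.cons_val', Matrix.empty_val', Matrix.cons_val_fin_one]
  · exact hJ.matrix_elem 1 1
  · exact (hJ.matrix_elem 1 0).neg
  · exact (hJ.matrix_elem 0 1).neg
  · exact hJ.matrix_elem 0 0

/-- **Print_cocycle, second half:** the cocycle is continuous in the group variable (at every point). -/
theorem A_continuous (z : Ball) (w : Fin 2 → ℂ) : Continuous fun g : U21 => A g z w := by
  simp only [A_apply]
  exact (continuous_coT z).matrix_mulVec continuous_const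

/-! ## Isotropy at `x₀ = 0`: `SU(2)` inside the stabiliser -/


-- port_pkg: scope closed for this part
end BallModel
end PerL34
end HodgeCM
end
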